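import Summits.MatrixMultiplication.MatrixMultiplication.Theorems.FarEdgeDescentLogRateSharp
import Literature.Computability.AlgebraicComplexity.RectangularExponentAlpha
import HarnessLib

/-!
# The far defect ladder with EXPLICIT ONSET: `δ_k ≤ 3/(8 ln k)` for `k ≥ 60`, `δ_k ≤ 1/(3 ln k)` for `k ≥ 193`,
# `δ_k ≤ 8/(25 ln k)` for `k ≥ 607` (route `SaturationLadder`, node `TailDescentTwo`, lens 1, gen 22, part C)

Cell `decomp-mm` (D-0178), lens 1 «grading / quantitative ladder», generation 22, part C.  Node of record: the crux
`TailDescentTwo` (stmt-MatrixMultiplication-29474); its quantitative ladder is the DEFECT `δ_k := ω(1,k,1) − (k+1)`.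
Parts A/B priced `δ_k` at finitely many `k` (`SaturationLadderLevelTwoK2 … K10`: level 2, `k ≤ 10`;
`SaturationLadderLevelOneFar`: level 1, thirteen points `k = 7 … 1000`, down to `δ₁₀₀₀ ≤ 1/24`).  A finite table
cannot tend to `0`; the two closed forms in the tree are `FarEdgeDescent.LogRate` (`δ_k ≤ ln 2/ln(2k+2)` for every
`k ≥ 1`, constant `ln 2 = 0.693`) and `FarEdgeDescent.LogRateSharp` (`δ_k ≤ c/ln k` for every `c > c₁ =
(3/2)ln 3 − 2 ln 2 = 0.26162`, but only EVENTUALLY: its onset `k₀(c)` is produced by a limit argument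
(`farEdge_exists_rate`, `Metric.continuousAt_iff`) and is not explicit).

THIS FILE makes the onset explicit.  The landed dilute-rate analysis of `FarEdgeDescentLogRateSharp` (the full
first-power certificate `cwFirstPowerIntegerCertificate_holds` at `q = k`, `ρ = 0`, `σ = t/(k+2+2t)`, the excess
identity/bound `farEdge_excess_identity / farEdge_excess_bound` and the X/Y balance `farEdge_balance`, all
IMPORTED, never restated) is run at a FIXED rational `t = s/m` instead of `t ↑ 1/2`; the balance side condition
`(1−2t) ln(k+1) ≥ 2 ln 2 − φ(t)`, `φ(t) = (1+t)ln(1+t) + t ln t`, multiplied by `m`, is the INTEGER inequality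
`4^m · m^{m+2s} ≤ (k+1)^{m−2s} · (m+s)^{m+s} · s^s`, and the constant `1 − 2t + φ(t)` is
`((m−2s) + (m+s)ln(m+s) + s ln s − (m+2s) ln m)/m`:

* `farRate_explicit` — for all `1 ≤ s`, `2s < m`, `k ≥ 2` with the integer balance inequality,
  `δ_k ≤ ( ((m−2s) + (m+s)ln(m+s) + s ln s − (m+2s)ln m)/m + 1/k ) / ln k`;
* `t = 1/3` (`s = 1, m = 3`): balance `⟺ 256(k+1) ≥ 15552 ⟺ k ≥ 60` (exact), constant `(1 + ln(256/243))/3 =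
  0.35071`: `farRate_sixty` and the clean **`farRate_three_eighths : k ≥ 60 → δ_k ≤ 3/(8 ln k)`**;
* `t = 3/8` (`s = 3, m = 8`): balance `⟺ (k+1)² · 11¹¹ · 27 ≥ 4⁸ · 8¹⁴ ⟺ k ≥ 193` (exact), constant
  `(2 + ln(11¹¹·27/8¹⁴))/8 = 0.32006`: `farRate_oneNinetyThree` and **`farRate_third : k ≥ 193 → δ_k ≤ 1/(3 ln k)`**;
* `t = 2/5` (`s = 2, m = 5`): balance `⟺ (k+1) · 7⁷ · 4 ≥ 4⁵ · 5⁹ ⟺ k ≥ 607` (exact), constant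
  `(1 + ln(7⁷·4/5⁹))/5 = 0.30454`: `farRate_sixHundredSeven` and **`farRate_eight_25ths : k ≥ 607 → δ_k ≤ 8/(25 ln k)`**.

So the tree's explicit-for-all-large-`k` constant drops from `ln 2 = 0.693` (`LogRate`) to `3/8` (`k ≥ 60`), `1/3`
(`k ≥ 193`) and `8/25 = 0.32` (`k ≥ 607`); as `t ↑ 1/2` the constant tends to `c₁ = 0.26162` while the exact onset
`exp((2 ln 2 − φ(t))/(1−2t)) − 1` blows up (`t = 9/20`: constant `0.2794`, onset `k ≥ 174304`) — that trade-off IS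
`LogRateSharp`.  Against part B's table: `1/(3 ln k)` passes `1/24` at `k = e⁸ ≈ 2981`, so the table is the sharper
instrument for `k ≤ 2980` and the closed form beyond.  Numerics of the three constants (`0.35071, 0.32006, 0.30454`)
and onsets are from the instrument `HOME/decomp-mm-lens-1/gen22/far_rate_consts.py`; the clean corollaries bound
the logarithms by `ln x ≤ x − 1` on two or three rational factors.  No named facts, no sorry, no definitions; the
prices are rung-0 currency and say nothing about a ZERO of `δ` (the hypothesis of `TailDescentTwo`).

References: Coppersmith 1982 (the `1/log k` order of the far rate) [Coppersmith1982]; Coppersmith–Winograd 1990 §6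
[CoppersmithWinograd1990]; Lotti–Romani 1983 Prop. 4.1 [LottiRomani1983]; Bürgisser–Clausen–Shokrollahi 1997,
Thm. 15.41 [BurgisserClausenShokrollahi1997]; Le Gall 2012 §3 [LeGall2012].
-/

set_option linter.dupNamespace false

noncomputable section

namespace Summit.MatrixMultiplication.MatrixMultiplication.Theorems.SaturationLadderFarRate

open Literature.Computability.AlgebraicComplexity
open Summit.MatrixMultiplication.MatrixMultiplication.Theorems.FarEdgeDescentLogRate
  (shannon₃ cwFullFirstPowerValue cwFirstPowerIntegerCertificate_holds)
open Summit.MatrixMultiplication.MatrixMultiplication.Theorems.FarEdgeDescentLogRateSharp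
  (farEdge_balance farEdge_excess_identity farEdge_excess_bound)

/-! ## The explicit rate at a fixed rational dilution `t = s/m` -/

/-- **Explicit far rate.**  For `1 ≤ s`, `2s < m`, `k ≥ 2` and the integer balance condition
`4^m · m^{m+2s} ≤ (k+1)^{m−2s} · ((m+s)^{m+s} · s^s)` (that is, `(1−2t) ln(k+1) ≥ 2 ln 2 − φ(t)` at `t = s/m`),
`ω(1,k,1) − (k+1) ≤ ( ((m−2s) + (m+s) ln(m+s) + s ln s − (m+2s) ln m)/m + 1/k ) / ln k`
(the full first-power `CW_k` certificate at `q = k`, `σ = t/(k+2+2t)`, `ρ = 0`).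
[cite: Coppersmith1982, §1] [cite: BurgisserClausenShokrollahi1997, Thm. 15.41] -/
theorem farRate_explicit (s m k : ℕ) (hs : 1 ≤ s) (hsm : 2 * s < m) (hk : 2 ≤ k)
    (hbal : 4 ^ m * m ^ (m + 2 * s) ≤ (k + 1) ^ (m - 2 * s) * ((m + s) ^ (m + s) * s ^ s)) :
    omegaRect ℂ 1 k 1 - (k + 1) ≤
      ((((m : ℝ) - 2 * s) + (((m : ℝ) + s) * Real.log ((m : ℝ) + s) + (s : ℝ) * Real.log s -
          ((m : ℝ) + 2 * s) * Real.log m)) / m + 1 / k) / Real.log k := by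
  have hm1 : 1 ≤ m := by omega
  have hmR : (0 : ℝ) < m := by exact_mod_cast (show 0 < m by omega)
  have hsR : (0 : ℝ) < s := by exact_mod_cast (show 0 < s by omega)
  have hsmR : 2 * (s : ℝ) < m := by exact_mod_cast hsm
  set t : ℝ := (s : ℝ) / (m : ℝ) with htdef
  have ht : 0 < t := div_pos hsR hmR
  have ht2 : t < 1 / 2 := by
    rw [htdef, div_lt_div_iff₀ hmR (by norm_num)]; linarith
  -- φ(t), kept as an opaque real number `φ` with its defining equation, and `m·φ` in closed form
  obtain ⟨φ, hφ⟩ : ∃ φ : ℝ, φ = (1 + t) * Real.log (1 + t) + t * Real.log t := ⟨_, rfl⟩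
  have hφm : (m : ℝ) * φ = ((m : ℝ) + s) * Real.log ((m : ℝ) + s) + (s : ℝ) * Real.log s -
      ((m : ℝ) + 2 * s) * Real.log m := by
    have h1 : 1 + t = ((m : ℝ) + s) / m := by rw [htdef]; field_simp
    rw [hφ, h1, htdef, Real.log_div (by positivity) hmR.ne', Real.log_div hsR.ne' hmR.ne']
    field_simp
    ring
  have hkR : (2 : ℝ) ≤ (k : ℝ) := by exact_mod_cast hk
  have hk0 : (0 : ℝ) < k := by linarith
  have hlogk : 0 < Real.log (k : ℝ) := Real.log_pos (by linarith)
  -- (1) balance hypothesis from the integer inequality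
  have hlarge : 2 * Real.log 2 - ((1 + t) * Real.log (1 + t) + t * Real.log t) ≤
      (1 - 2 * t) * Real.log ((k : ℝ) + 1) := by
    rw [← hφ]
    have hbalR : (4 : ℝ) ^ m * (m : ℝ) ^ (m + 2 * s) ≤
        ((k : ℝ) + 1) ^ (m - 2 * s) * (((m : ℝ) + s) ^ (m + s) * (s : ℝ) ^ s) := by
      exact_mod_cast hbal
    have hlog := Real.log_le_log (by positivity) hbalR
    have eL : Real.log ((4 : ℝ) ^ m * (m : ℝ) ^ (m + 2 * s)) =
        (m : ℝ) * (2 * Real.log 2) + ((m : ℝ) + 2 * s) * Real.log m := by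
      rw [Real.log_mul (by positivity) (by positivity), Real.log_pow, Real.log_pow,
        show (4 : ℝ) = 2 ^ 2 by norm_num, Real.log_pow]
      push_cast
      ring
    have ecast : ((m - 2 * s : ℕ) : ℝ) = (m : ℝ) - 2 * s := by
      rw [Nat.cast_sub (by omega)]; push_cast; ring
    have eR : Real.log (((k : ℝ) + 1) ^ (m - 2 * s) * (((m : ℝ) + s) ^ (m + s) * (s : ℝ) ^ s)) =
        ((m : ℝ) - 2 * s) * Real.log ((k : ℝ) + 1) +
          (((m : ℝ) + s) * Real.log ((m : ℝ) + s) + (s : ℝ) * Real.log s) := by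
      rw [Real.log_mul (by positivity) (by positivity), Real.log_mul (by positivity) (by positivity),
        Real.log_pow, Real.log_pow, Real.log_pow, ecast]
      push_cast
      ring
    rw [eL, eR] at hlog
    have key : (m : ℝ) * (2 * Real.log 2 - φ) ≤ (m : ℝ) * ((1 - 2 * t) * Real.log ((k : ℝ) + 1)) := by
      have e1 : (m : ℝ) * (2 * Real.log 2 - φ) = (m : ℝ) * (2 * Real.log 2) -
          (((m : ℝ) + s) * Real.log ((m : ℝ) + s) + (s : ℝ) * Real.log s - ((m : ℝ) + 2 * s) * Real.log m) := by
        rw [← hφm]; ring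
      have e2 : (m : ℝ) * ((1 - 2 * t) * Real.log ((k : ℝ) + 1)) =
          ((m : ℝ) - 2 * s) * Real.log ((k : ℝ) + 1) := by
        rw [htdef]; field_simp
      rw [e1, e2]
      linarith
    exact le_of_mul_le_mul_left key hmR
  -- (2) the certificate at q = k, σ = t/K, ρ = 0
  set K : ℝ := (k : ℝ) + 2 + 2 * t with hK
  have hK0 : 0 < K := by rw [hK]; linarith
  clear_value K
  have hKne : K ≠ 0 := hK0.ne'
  have hcert := cwFirstPowerIntegerCertificate_holds k k m s 0 hk (by omega) hm1
  have hσ : ((s : ℝ) / (((k : ℝ) + 2) * m + 2 * s + ((0 : ℕ) : ℝ))) = t / K := by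
    rw [Nat.cast_zero, add_zero, htdef, hK, htdef]
    field_simp
  have hρ : (((0 : ℕ) : ℝ) / (((k : ℝ) + 2) * m + 2 * s + ((0 : ℕ) : ℝ))) = 0 := by simp
  rw [hσ, hρ] at hcert
  have hβ : (1 - 2 * (t / K) - 0) / ((k : ℝ) + 2) = 1 / K := by
    have hk2ne : (k : ℝ) + 2 ≠ 0 := by positivity
    field_simp
    rw [hK]; ring
  have eX1 : (k : ℝ) * (1 / K) + 2 * (t / K) = ((k : ℝ) + 2 * t) / K := by ring
  have eX2 : 2 * (1 / K) = 2 / K := by ring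
  have eY1 : 1 / K + 0 + t / K = (1 + t) / K := by ring
  have eY2 : (k : ℝ) * (1 / K) + 1 / K = ((k : ℝ) + 1) / K := by ring
  have hbal' : shannon₃ ((1 + t) / K) (((k : ℝ) + 1) / K) (t / K) ≤
      shannon₃ (((k : ℝ) + 2 * t) / K) (2 / K) 0 := by
    rw [hK]; exact farEdge_balance hkR ht ht2 hlarge
  have hval : cwFullFirstPowerValue k k (t / K) 0 =
      (Real.log ((k : ℝ) + 2) -
          shannon₃ ((1 + t) / K) (((k : ℝ) + 1) / K) (t / K)) / (1 / K * Real.log (k : ℝ)) := by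
    unfold cwFullFirstPowerValue
    rw [hβ, eX1, eX2, eY1, eY2, min_eq_right hbal']
  rw [hval] at hcert
  set S : ℝ := shannon₃ ((1 + t) / K) (((k : ℝ) + 1) / K) (t / K) with hS
  clear_value S
  -- (3) excess identity and bound
  have hid : K * (Real.log ((k : ℝ) + 2) - S) - ((k : ℝ) + 1) * Real.log (k : ℝ) =
      K * (Real.log ((k : ℝ) + 2) - Real.log K) + ((k : ℝ) + 1) * (Real.log ((k : ℝ) + 1) - Real.log (k : ℝ)) +
        φ := by
    rw [hS, hK, hφ]; exact farEdge_excess_identity hkR ht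
  have hbd : K * (Real.log ((k : ℝ) + 2) - Real.log K) +
      ((k : ℝ) + 1) * (Real.log ((k : ℝ) + 1) - Real.log (k : ℝ)) + φ ≤ 1 - 2 * t + φ + 1 / (k : ℝ) := by
    rw [hK, hφ]; exact farEdge_excess_bound hkR ht
  have hmid : omegaRect ℂ 1 1 (k : ℝ) = omegaRect ℂ 1 (k : ℝ) 1 := (omegaRect_one_mid_one ℂ (k : ℝ)).symm
  rw [hmid] at hcert
  -- the constant: 1 − 2t + φ = ((m − 2s) + m φ)/m
  have hconst : 1 - 2 * t + φ = (((m : ℝ) - 2 * s) + (((m : ℝ) + s) * Real.log ((m : ℝ) + s) +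
      (s : ℝ) * Real.log s - ((m : ℝ) + 2 * s) * Real.log m)) / m := by
    rw [← hφm, htdef]; field_simp
  set C : ℝ := (((m : ℝ) - 2 * s) + (((m : ℝ) + s) * Real.log ((m : ℝ) + s) +
      (s : ℝ) * Real.log s - ((m : ℝ) + 2 * s) * Real.log m)) / m with hC
  clear_value C
  have hΦ : K * (Real.log ((k : ℝ) + 2) - S) - ((k : ℝ) + 1) * Real.log (k : ℝ) ≤ C + 1 / (k : ℝ) := by
    rw [hid, ← hconst]; linarith
  have hrew : (Real.log ((k : ℝ) + 2) - S) / (1 / K * Real.log (k : ℝ)) =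
      (K * (Real.log ((k : ℝ) + 2) - S)) / Real.log (k : ℝ) := by
    field_simp
  rw [hrew] at hcert
  have hfin : (K * (Real.log ((k : ℝ) + 2) - S)) / Real.log (k : ℝ) ≤
      (C + 1 / (k : ℝ)) / Real.log (k : ℝ) + ((k : ℝ) + 1) := by
    rw [div_add' _ _ _ hlogk.ne', div_le_div_iff_of_pos_right hlogk]
    linarith
  have hgoal : omegaRect ℂ 1 (k : ℝ) 1 - ((k : ℝ) + 1) ≤ (C + 1 / (k : ℝ)) / Real.log (k : ℝ) := by linarith
  exact_mod_cast hgoal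

/-- Monotone transport of the integer balance condition from the exact onset `k₀` to every `k + 1 ≥ k₀`. -/
theorem balance_of_le {a c e k₀ k : ℕ} (h0 : a ≤ k₀ ^ e * c) (hk : k₀ ≤ k + 1) : a ≤ (k + 1) ^ e * c :=
  h0.trans (Nat.mul_le_mul (Nat.pow_le_pow_left hk _) le_rfl)

/-! ## `t = 1/3`: onset `k = 60`, constant `(1 + ln(256/243))/3 = 0.35071`, clean form `3/(8 ln k)` -/

/-- **`δ_k ≤ ((1 + ln(256/243))/3 + 1/k)/ln k` for every integer `k ≥ 60`** (`t = 1/3`; the onset is exact: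
`256·(k+1) ≥ 4³·3⁵ = 15552 ⟺ k ≥ 60`). [cite: Coppersmith1982, §1] [cite: LottiRomani1983, Prop. 4.1] -/
theorem farRate_sixty (k : ℕ) (hk : 60 ≤ k) :
    omegaRect ℂ 1 k 1 - (k + 1) ≤ ((1 + Real.log (256 / 243)) / 3 + 1 / k) / Real.log k := by
  have h := farRate_explicit 1 3 k (by norm_num) (by norm_num) (by omega)
    (balance_of_le (k₀ := 61) (by norm_num) (by omega))
  have e : ((((3 : ℕ) : ℝ) - 2 * ((1 : ℕ) : ℝ)) + ((((3 : ℕ) : ℝ) + ((1 : ℕ) : ℝ)) *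
      Real.log (((3 : ℕ) : ℝ) + ((1 : ℕ) : ℝ)) + ((1 : ℕ) : ℝ) * Real.log ((1 : ℕ) : ℝ) -
      (((3 : ℕ) : ℝ) + 2 * ((1 : ℕ) : ℝ)) * Real.log ((3 : ℕ) : ℝ))) / ((3 : ℕ) : ℝ) =
      (1 + Real.log (256 / 243)) / 3 := by
    have hl : Real.log (256 / 243 : ℝ) = 4 * Real.log 4 - 5 * Real.log 3 := by
      rw [Real.log_div (by norm_num) (by norm_num), show (256 : ℝ) = 4 ^ 4 by norm_num,
        show (243 : ℝ) = 3 ^ 5 by norm_num, Real.log_pow, Real.log_pow]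
      push_cast; ring
    rw [hl]; push_cast; rw [Real.log_one]; norm_num
  rw [e] at h
  exact h

/-- **`δ_k ≤ 3/(8 ln k)` for every integer `k ≥ 60`** (`ln(256/243) ≤ 13/243` and `1/k ≤ 1/60`:
`256/729 + 1/60 = 0.3678 ≤ 3/8`). [cite: Coppersmith1982, §1] [cite: LottiRomani1983, Prop. 4.1] -/
theorem farRate_three_eighths (k : ℕ) (hk : 60 ≤ k) :
    omegaRect ℂ 1 k 1 - (k + 1) ≤ 3 / (8 * Real.log k) := by
  have h := farRate_sixty k hk
  have hkR : (60 : ℝ) ≤ k := by exact_mod_cast hk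
  have hlogk : 0 < Real.log (k : ℝ) := Real.log_pos (by linarith)
  have hL : Real.log (256 / 243 : ℝ) ≤ 256 / 243 - 1 := Real.log_le_sub_one_of_pos (by norm_num)
  have h1k : 1 / (k : ℝ) ≤ 1 / 60 := one_div_le_one_div_of_le (by norm_num) hkR
  have hc : (1 + Real.log (256 / 243)) / 3 + 1 / (k : ℝ) ≤ 3 / 8 := by linarith
  calc omegaRect ℂ 1 k 1 - (k + 1) ≤ ((1 + Real.log (256 / 243)) / 3 + 1 / k) / Real.log k := h
    _ ≤ (3 / 8) / Real.log k := by gcongr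
    _ = 3 / (8 * Real.log k) := by rw [div_div]

/-! ## `t = 3/8`: onset `k = 193`, constant `(2 + ln(11¹¹·27/8¹⁴))/8 = 0.32006`, clean form `1/(3 ln k)` -/

/-- **`δ_k ≤ ((2 + ln(7703415106497/4398046511104))/8 + 1/k)/ln k` for every integer `k ≥ 193`** (`t = 3/8`,
`7703415106497 = 11¹¹·27`, `4398046511104 = 8¹⁴`; exact onset `(k+1)²·11¹¹·27 ≥ 4⁸·8¹⁴ ⟺ k ≥ 193`).
[cite: Coppersmith1982, §1] [cite: LottiRomani1983, Prop. 4.1] -/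
theorem farRate_oneNinetyThree (k : ℕ) (hk : 193 ≤ k) :
    omegaRect ℂ 1 k 1 - (k + 1) ≤
      ((2 + Real.log (7703415106497 / 4398046511104)) / 8 + 1 / k) / Real.log k := by
  have h := farRate_explicit 3 8 k (by norm_num) (by norm_num) (by omega)
    (balance_of_le (k₀ := 194) (by norm_num) (by omega))
  have e : ((((8 : ℕ) : ℝ) - 2 * ((3 : ℕ) : ℝ)) + ((((8 : ℕ) : ℝ) + ((3 : ℕ) : ℝ)) *
      Real.log (((8 : ℕ) : ℝ) + ((3 : ℕ) : ℝ)) + ((3 : ℕ) : ℝ) * Real.log ((3 : ℕ) : ℝ) -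
      (((8 : ℕ) : ℝ) + 2 * ((3 : ℕ) : ℝ)) * Real.log ((8 : ℕ) : ℝ))) / ((8 : ℕ) : ℝ) =
      (2 + Real.log (7703415106497 / 4398046511104)) / 8 := by
    have hl : Real.log (7703415106497 / 4398046511104 : ℝ) =
        11 * Real.log 11 + 3 * Real.log 3 - 14 * Real.log 8 := by
      rw [Real.log_div (by norm_num) (by norm_num), show (7703415106497 : ℝ) = 11 ^ 11 * 3 ^ 3 by norm_num,
        show (4398046511104 : ℝ) = 8 ^ 14 by norm_num, Real.log_mul (by norm_num) (by norm_num),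
        Real.log_pow, Real.log_pow, Real.log_pow]
      push_cast; ring
    rw [hl]; push_cast; norm_num
  rw [e] at h
  exact h

/-- **`δ_k ≤ 1/(3 ln k)` for every integer `k ≥ 193`** (the logarithm `ln(1.75155…)` bounded by `x − 1` on the three
factors `6/5 · 6/5 · 21398375295825/17592186044416`: `≤ 0.61636`; with `1/k ≤ 1/193`: `(2 + 0.61636)/8 + 1/193 =
0.3322 ≤ 1/3`). [cite: Coppersmith1982, §1] [cite: LottiRomani1983, Prop. 4.1] -/
theorem farRate_third (k : ℕ) (hk : 193 ≤ k) :
    omegaRect ℂ 1 k 1 - (k + 1) ≤ 1 / (3 * Real.log k) := by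
  have h := farRate_oneNinetyThree k hk
  have hkR : (193 : ℝ) ≤ k := by exact_mod_cast hk
  have hlogk : 0 < Real.log (k : ℝ) := Real.log_pos (by linarith)
  have hsplit : (7703415106497 / 4398046511104 : ℝ) =
      (6 / 5) * ((6 / 5) * (21398375295825 / 17592186044416)) := by norm_num
  have hL : Real.log (7703415106497 / 4398046511104 : ℝ) ≤
      (6 / 5 - 1) + ((6 / 5 - 1) + (21398375295825 / 17592186044416 - 1)) := by
    rw [hsplit, Real.log_mul (by norm_num) (by norm_num), Real.log_mul (by norm_num) (by norm_num)]
    exact add_le_add (Real.log_le_sub_one_of_pos (by norm_num))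
      (add_le_add (Real.log_le_sub_one_of_pos (by norm_num)) (Real.log_le_sub_one_of_pos (by norm_num)))
  have h1k : 1 / (k : ℝ) ≤ 1 / 193 := one_div_le_one_div_of_le (by norm_num) hkR
  have hc : (2 + Real.log (7703415106497 / 4398046511104)) / 8 + 1 / (k : ℝ) ≤ 1 / 3 := by
    norm_num at hL; linarith
  calc omegaRect ℂ 1 k 1 - (k + 1)
      ≤ ((2 + Real.log (7703415106497 / 4398046511104)) / 8 + 1 / k) / Real.log k := h
    _ ≤ (1 / 3) / Real.log k := by gcongr
    _ = 1 / (3 * Real.log k) := by rw [div_div]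

/-! ## `t = 2/5`: onset `k = 607`, constant `(1 + ln(7⁷·4/5⁹))/5 = 0.30454`, clean form `8/(25 ln k)` -/

/-- **`δ_k ≤ ((1 + ln(3294172/1953125))/5 + 1/k)/ln k` for every integer `k ≥ 607`** (`t = 2/5`,
`3294172 = 7⁷·4`, `1953125 = 5⁹`; exact onset `(k+1)·7⁷·4 ≥ 4⁵·5⁹ ⟺ k ≥ 607`).
[cite: Coppersmith1982, §1] [cite: LottiRomani1983, Prop. 4.1] -/
theorem farRate_sixHundredSeven (k : ℕ) (hk : 607 ≤ k) :
    omegaRect ℂ 1 k 1 - (k + 1) ≤ ((1 + Real.log (3294172 / 1953125)) / 5 + 1 / k) / Real.log k := by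
  have h := farRate_explicit 2 5 k (by norm_num) (by norm_num) (by omega)
    (balance_of_le (k₀ := 608) (by norm_num) (by omega))
  have e : ((((5 : ℕ) : ℝ) - 2 * ((2 : ℕ) : ℝ)) + ((((5 : ℕ) : ℝ) + ((2 : ℕ) : ℝ)) *
      Real.log (((5 : ℕ) : ℝ) + ((2 : ℕ) : ℝ)) + ((2 : ℕ) : ℝ) * Real.log ((2 : ℕ) : ℝ) -
      (((5 : ℕ) : ℝ) + 2 * ((2 : ℕ) : ℝ)) * Real.log ((5 : ℕ) : ℝ))) / ((5 : ℕ) : ℝ) =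
      (1 + Real.log (3294172 / 1953125)) / 5 := by
    have hl : Real.log (3294172 / 1953125 : ℝ) = 7 * Real.log 7 + 2 * Real.log 2 - 9 * Real.log 5 := by
      rw [Real.log_div (by norm_num) (by norm_num), show (3294172 : ℝ) = 7 ^ 7 * 2 ^ 2 by norm_num,
        show (1953125 : ℝ) = 5 ^ 9 by norm_num, Real.log_mul (by norm_num) (by norm_num),
        Real.log_pow, Real.log_pow, Real.log_pow]
      push_cast; ring
    rw [hl]; push_cast; norm_num
  rw [e] at h
  exact h

/-- **`δ_k ≤ 8/(25 ln k)` for every integer `k ≥ 607`** (`ln(1.68661…) ≤ 0.57127` from the factors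
`6/5 · 6/5 · 823543/703125`; `(1 + 0.57127)/5 + 1/607 = 0.3159 ≤ 8/25`).
[cite: Coppersmith1982, §1] [cite: LottiRomani1983, Prop. 4.1] -/
theorem farRate_eight_25ths (k : ℕ) (hk : 607 ≤ k) :
    omegaRect ℂ 1 k 1 - (k + 1) ≤ 8 / (25 * Real.log k) := by
  have h := farRate_sixHundredSeven k hk
  have hkR : (607 : ℝ) ≤ k := by exact_mod_cast hk
  have hlogk : 0 < Real.log (k : ℝ) := Real.log_pos (by linarith)
  have hsplit : (3294172 / 1953125 : ℝ) = (6 / 5) * ((6 / 5) * (823543 / 703125)) := by norm_num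
  have hL : Real.log (3294172 / 1953125 : ℝ) ≤
      (6 / 5 - 1) + ((6 / 5 - 1) + (823543 / 703125 - 1)) := by
    rw [hsplit, Real.log_mul (by norm_num) (by norm_num), Real.log_mul (by norm_num) (by norm_num)]
    exact add_le_add (Real.log_le_sub_one_of_pos (by norm_num))
      (add_le_add (Real.log_le_sub_one_of_pos (by norm_num)) (Real.log_le_sub_one_of_pos (by norm_num)))
  have h1k : 1 / (k : ℝ) ≤ 1 / 607 := one_div_le_one_div_of_le (by norm_num) hkR
  have hc : (1 + Real.log (3294172 / 1953125)) / 5 + 1 / (k : ℝ) ≤ 8 / 25 := by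
    norm_num at hL; linarith
  calc omegaRect ℂ 1 k 1 - (k + 1)
      ≤ ((1 + Real.log (3294172 / 1953125)) / 5 + 1 / k) / Real.log k := h
    _ ≤ (8 / 25) / Real.log k := by gcongr
    _ = 8 / (25 * Real.log k) := by rw [div_div]

end Summit.MatrixMultiplication.MatrixMultiplication.Theorems.SaturationLadderFarRate

end
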